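import Summits.QuantumFields.BalabanUV.T4Continuum.Support.T4TrajectoryDensityAssembly

/-!
# `T4Continuum.T4TrajectoryDensityAssemblyMod` — THE CENTRED PERTURBATION SLICE `hP` ASSEMBLED FROM THE LIVE GENERATIONS'
# TRANSPORTED RESPONSE MODULI (not from their slice radii): the fresh response of a dressed generation is paid in the currency
# the transport induction already proves — `(4/r)·stepProd α k″ k·gen` with the BIRTH radius `r` and the scale-free step factor
# `a·(1 + 4θ/ϱ) ≤ α` — so that NO chart radius enters any constant (cell `pub-balaban`, sub-cell `t4`, spine estimate NE1′
# (node O3b/H2); NE1′ formalisation swarm `b2b-balaban-t4-ne1p-formalise-*`, leaf prover 08, own-initiative SUPPLIER item «R-a′»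
# replacing the withdrawn «R-a» after leaf prover 04's caution, HOME/CLAIMS.log l.8748 / l.8878 / l.9001; tree target
# `Summits/QuantumFields/BalabanUV/T4Continuum/Support/`; ADDITIVE — imports `T4TrajectoryDensityAssembly` ONLY; the lineage's
# one-step lemmas BY NAME; modifies nothing)

HONEST FRAMING.  Finite four-torus, rung (B)+1 only — NOT infinite volume, NOT a mass gap, NOT the Clay problem, NOT summit
progress.  «continuum YM on T⁴ ⇐ BetaPertH ∧ nine spine estimates (0/9 proved); BetaPertH ⇐ (D1) ∧ (D4) ∧ CAP+tail; G-an2-4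
gates asym, D1 and NE2/3/4».  [folklore] kernel glue (one strong induction over the lineage's `birthSlice_wOp_shift_dressed`,
`opSliceOn_wOp_dressed`, `contStepLawOn_of_opSlice_windowed`, `ContStepLawOn.respMod_continue`, `respMod_raw_of_birthSlice`,
`hcov_add`, `hpair_add`), 0 sorry, 0 citations; every window, weight, radius, defect and count is a HYPOTHESIS about the
cell's instantiation — nothing of Bałaban's densities or the cell's D-terms is asserted.

WHY (located finding F-ne1pleaf08-1 and leaf-04's caution).  `T4TrajectoryDensityAssembly.pertSlice_under_history` sizes the
centred observable-attached exponent of a met component by the SLICE data of its live generations: `s1 b k = ‖c b k‖·Σ_p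
4·Asz p k / rs p k · δf b k p`, the Cauchy constant `4·Asz/rs` carrying the CURRENT slice radius `rs` — which shrinks at every met
step (`hrs_dec`) and is synchronised inside a component to its oldest generation (`hmargin`).  Row S2's END-F′ (p212485) then
needs a uniform floor `r_* ≤ rs` and `‖c‖·r ≤ m·r_*`, and composed with row S1's schedule a uniform floor costs `K·r_*` of birth
window (`DressedTransportScheduled.floor_window_budget`, p212880) — cutoff-dependent constants (trigger caveat k1); a geometric
floor is jointly unsatisfiable with `hmargin` in mixed-age components (leaf-04, l.8878).  THE RADIUS IS IN THE WRONG CURRENCY: the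
transport induction (`T4TrajectoryModulus.moduliAt_of_birth_cont_dep`) proves for every live generation a RESPONSE MODULUS
`(4/r)·stepProd α k″ k·gen f k″` on the raw chart pairs of its CURRENT window — birth radius `r`, per-step factor
`a·(1+4θ/ϱ) ≤ α` in which only the cutoff-free RATIO `θ/ϱ` appears — and the fresh pair of a generation IS such a pair up to gauge
(`hpairx`, `hinv`, base point in the window by `hN2cx`).  So the fresh response is `≤ modulus × transverse defect`, with no radius.

CONTENTS (§24 of the (w2)-split numbering).
* `pertSlice_fresh_mod` — `T4TrajectoryDensityFresh.pertSlice_fresh` with the SIZE taken from a response modulus `M` of the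
  carried term on the raw pairs of its window (holomorphy still from its slice): size `M·δ`.
* `pertSlice_component_mod` — the component sum: size `‖c‖·Σ_i M i·δ i`.
* **`slicesModuli_under_history`** — ONE strong induction on the step, all families at once: under `RanBelow Gate k` every live
  generation `(f, k″)` has (i) a birth slice on `𝒦 f k″ k` of radius `rs f k″ k` and size `Asz f k″ k ≥ 0` (as in §22, with the
  budget `s + s1 ≤ 1` read off the gate) AND (ii) the response modulus `(4/r)·stepProd α k″ k·gen f k″` on
  `RawAdm latMove latN (𝒦 f k″ k)` within the window `w` — (ii) at birth by `respMod_raw_of_birthSlice`, continued by the step law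
  of the component's normalised operation (`opSliceOn_wOp_dressed` fed with the centred perturbation slice assembled from the
  moduli of step `k`, `contStepLawOn_of_opSlice_windowed`, `respMod_continue`, domination `e³·(1+4θ/ϱ) ≤ α`).
* **`pertSlice_under_history_mod`** — EXACTLY the binder `hP` of the gated capstones with
  `s₁ b k := ‖c b k‖·Σ_{p∈S k b} (4/r·stepProd α p.2 k·gen p.1 p.2)·δf b k p`: a CLOSED FORM in the booking's own envelope currency
  (the Spine face `DressedTransportAssembledMod` bounds it by `m·Σ_{f} envVar (4c_δ/r) (ψ·α) f k` outright from `‖c b k‖ ≤ m`).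
-/

namespace Summit.QuantumFields.BalabanUV.T4Continuum.T4TrajectoryDensityDressed

open MeasureTheory Set Metric Filter Finset
open Literature.MathematicalPhysics.QuantumFieldTheory.Balaban1983to89
open T4TermFormat T4TermFormat.Booking T4GatedBooking T4TrajectoryComparison T4TrajectoryModulus
open T4BirthChartTransport (GaugeInvariant BirthSlice RelGauge)
open T4BlockTransport (Fld NDir latMove latN latMove_zero)
open T4TrajectoryDensity

noncomputable section

/-! ## §24a The fresh supplier sized by a response modulus [folklore] -/

section FreshMod

variable {V : Type*} [AddCommGroup V] [MeasurableSpace V] {Dir : Type*} {move : V → Dir → ℂ → V} {N : Dir → ℝ}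

/-- **THE FRESH SUPPLIER, MODULUS FORM.**  `pertSlice_fresh` VERBATIM except for the SIZE: instead of the Cauchy constant `4A/r`
of the carried term's current slice, a RESPONSE MODULUS `M ≥ 0` of `G` on the raw chart pairs of its window `𝒦big` (within `w`) is
used — the fresh pair `(move U₀ d t + z₁, move U₀ d t + z)` is, up to the gauge relation (`hpair`, `hinv`), a raw chart pair based
at `move U₀ d t + z₁ ∈ 𝒦big` (`hnestC`) of defect `δ ≤ w`, so the centred term is bounded by `M·δ` on the tube.  Holomorphy in `t`
still comes from the slice (`hsl`, radii `ϱ < ϱ₁ ≤ r`). [folklore] -/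
theorem pertSlice_fresh_mod {G : V → ℂ} {rel : V → V → Prop} {μ : Measure V} {𝒦 𝒦big : Set V} {z₁ : V}
    {w ϱ ϱ₁ r A δ M : ℝ}
    (hmove : ∀ (U z : V) (d : Dir) (t : ℂ), move (U + z) d t = move U d t + z)
    (hmove0 : ∀ (U : V) (d : Dir), move U d 0 = U)
    (hinv : GaugeInvariant rel G) (hsl : BirthSlice G move N 𝒦big w r A)
    (hmod : RespMod G (RawAdm move N 𝒦big) w M) (hM : 0 ≤ M)
    (hϱ : ϱ < ϱ₁) (hϱ₁ : 0 < ϱ₁) (hϱ₁r : ϱ₁ ≤ r)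
    (hnest : ∀ᵐ z ∂μ, ∀ U₀ ∈ 𝒦, U₀ + z ∈ 𝒦big)
    (hnestC : ∀ U₀ ∈ 𝒦, ∀ d : Dir, 0 < N d → N d ≤ w → ∀ t ∈ tube (ϱ₁ / N d), move U₀ d t + z₁ ∈ 𝒦big)
    (hpair : ∀ U₀ ∈ 𝒦, ∀ d : Dir, 0 < N d → N d ≤ w →
      ∀ᵐ z ∂μ, ∀ t ∈ tube (ϱ₁ / N d), RelGauge rel move N (move U₀ d t + z₁) (move U₀ d t + z) δ)
    (hδw : δ ≤ w) (hmeas : ∀ U, AEStronglyMeasurable (fun z => G (U + z)) μ) :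
    PertSlice (fun U z => G (U + z) - G (U + z₁)) μ move N 𝒦 w ϱ (M * δ) := by
  refine pertSlice_of_sup fun U₀ hU₀ d hd hdw => ?_
  have hsub : tube (ϱ₁ / N d) ⊆ tube (r / N d) := tube_mono (div_le_div_of_nonneg_right hϱ₁r hd.le)
  -- holomorphy of the reference summand along the chart, from the birth slice at the base `U₀ + z₁ ∈ 𝒦big`
  have hz₁ : U₀ + z₁ ∈ 𝒦big := by
    have h0 := hnestC U₀ hU₀ d hd hdw ((0 : ℝ) : ℂ) (ofReal_mem_tube (div_pos hϱ₁ hd) ⟨le_rfl, zero_le_one⟩)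
    rwa [Complex.ofReal_zero, hmove0] at h0
  have href : DifferentiableOn ℂ (fun t => G (move U₀ d t + z₁)) (tube (ϱ₁ / N d)) := by
    obtain ⟨Dm, hdiff, -, hDm⟩ := hsl (U₀ + z₁) hz₁ d hd hdw
    have e : (fun t => G (move U₀ d t + z₁)) = fun t => G (move (U₀ + z₁) d t) := by
      funext t
      rw [hmove]
    rw [e]
    exact hdiff.mono (hsub.trans (tube_subset hDm))
  refine ⟨tube (ϱ₁ / N d), isOpen_tube _, fun x hx => closedBall_subset_tube hd hϱ hx,
    fun t _ => (hmeas (move U₀ d t)).sub aestronglyMeasurable_const, ?_, ?_⟩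
  · filter_upwards [hnest] with z hz
    obtain ⟨Dm, hdiff, -, hDm⟩ := hsl (U₀ + z) (hz U₀ hU₀) d hd hdw
    have e : (fun t => G (move U₀ d t + z)) = fun t => G (move (U₀ + z) d t) := by
      funext t
      rw [hmove]
    have hmain : DifferentiableOn ℂ (fun t => G (move U₀ d t + z)) (tube (ϱ₁ / N d)) := by
      rw [e]
      exact hdiff.mono (hsub.trans (tube_subset hDm))
    exact hmain.sub href
  · filter_upwards [hpair U₀ hU₀ d hd hdw] with z hz t ht
    -- the fresh pair is a raw chart pair (up to gauge) based at `move U₀ d t + z₁ ∈ 𝒦big`: pay with the modulus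
    obtain ⟨d', hd', hd'δ, hrel⟩ := hz t ht
    rw [hinv _ _ hrel]
    calc ‖G (move (move U₀ d t + z₁) d' 1) - G (move U₀ d t + z₁)‖ ≤ M * N d' :=
          hmod _ _ _ ⟨hnestC U₀ hU₀ d hd hdw t ht, d', hd', le_rfl, rfl⟩ (hd'δ.trans hδw)
      _ ≤ M * δ := mul_le_mul_of_nonneg_left hd'δ hM

/-- **SUMS OVER THE LIVE GENERATIONS, MODULUS FORM**: `pertSlice_component` with every generation's response paid by its modulus —
size `‖c‖·Σ_i M i·δ i`. [folklore] -/
theorem pertSlice_component_mod {ι : Type*} (S : Finset ι) {G : ι → V → ℂ} {rel : ι → V → V → Prop}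
    {μ : Measure V} {𝒦 : Set V} {𝒦big : ι → Set V} {D : Set V} {z₁ : V}
    {w ϱ ϱ₁ : ℝ} {r A δ M : ι → ℝ} (c : ℂ)
    (hmove : ∀ (U z : V) (d : Dir) (t : ℂ), move (U + z) d t = move U d t + z)
    (hmove0 : ∀ (U : V) (d : Dir), move U d 0 = U)
    (hinv : ∀ i ∈ S, GaugeInvariant (rel i) (G i))
    (hsl : ∀ i ∈ S, BirthSlice (G i) move N (𝒦big i) w (r i) (A i))
    (hmod : ∀ i ∈ S, RespMod (G i) (RawAdm move N (𝒦big i)) w (M i)) (hM : ∀ i ∈ S, 0 ≤ M i)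
    (hr : ∀ i ∈ S, ϱ₁ ≤ r i) (hϱ : ϱ < ϱ₁) (hϱ₁ : 0 < ϱ₁)
    (hDμ : ∀ᵐ z ∂μ, z ∈ D) (hN1 : ∀ i ∈ S, ∀ z ∈ D, ∀ U₀ ∈ 𝒦, U₀ + z ∈ 𝒦big i)
    (hN2c : ∀ i ∈ S, ∀ U₀ ∈ 𝒦, ∀ p : Dir, 0 < N p → N p ≤ w →
      ∀ t ∈ tube (ϱ₁ / N p), move U₀ p t + z₁ ∈ 𝒦big i)
    (hpair : ∀ i ∈ S, ∀ U₀ ∈ 𝒦, ∀ p : Dir, 0 < N p → N p ≤ w →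
      ∀ᵐ z ∂μ, ∀ t ∈ tube (ϱ₁ / N p), RelGauge (rel i) move N (move U₀ p t + z₁) (move U₀ p t + z) (δ i))
    (hδw : ∀ i ∈ S, δ i ≤ w) (hmeas : ∀ i ∈ S, ∀ U, AEStronglyMeasurable (fun z => G i (U + z)) μ) :
    PertSlice (fun U z => c * ∑ i ∈ S, (G i (U + z) - G i (U + z₁))) μ move N 𝒦 w ϱ
      (‖c‖ * ∑ i ∈ S, M i * δ i) :=
  (PertSlice.sum S fun i hi =>
    pertSlice_fresh_mod hmove hmove0 (hinv i hi) (hsl i hi) (hmod i hi) (hM i hi) hϱ hϱ₁ (hr i hi)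
      (hDμ.mono fun z hz U₀ hU₀ => hN1 i hi z hz U₀ hU₀) (hN2c i hi) (hpair i hi) (hδw i hi) (hmeas i hi)).const_mul c

end FreshMod

/-! ## §24b Slices AND moduli of every live generation under the history; the binder `hP` in modulus form [folklore] -/

section AssemblyMod

variable {R : Type*} [NormedRing R] [NormedAlgebra ℂ R] [MeasurableSpace R] {d : ℕ}
variable {B : Booking} {T : Trajectory B}

/-- **SLICES AND RESPONSE MODULI OF EVERY LIVE GENERATION UNDER THE HISTORY** (strong induction on the step, all families at
once).  Hypotheses: births `hsl` (size `gen`, radius `r > 0`); the dressed step law `hFn` and class membership `h𝒢`; per-component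
action data `hB`/`hE`; the centred exponent of each component = the fresh sum over its live generations (`hQ`); the size/radius
recursions `hAsz_*`/`hrs_*` AS EQUALITIES and the modulus-form budget `hs1 : s1 b k = ‖c b k‖·Σ_p (4/r·stepProd α p.2 k·gen p)·δf b k p`;
radii ordered (`hrs_dec`, `hmargin` — ORDERINGS ONLY, no floor); own and cross-family nesting, complex margins, fresh pairs,
measurability; fluctuation domains non-empty of diameter `θ b k ≤ w`, chart radii positive, (N2) `hN2`, domination
`e³·(1 + 4θ b k/ϱ b k′ k) ≤ α k`, `α ≥ 0`, gauge invariance; and the gate implying the budget `s b k + s1 b k ≤ 1` ⟹ for every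
`k ≤ K` under `RanBelow Gate k`, every generation `(f, k″)` alive at `k` has
(i) `0 ≤ Asz f k″ k ∧ BirthSlice (Fn f k″ k) latMove latN (𝒦 f k″ k) w (rs f k″ k) (Asz f k″ k)` and
(ii) `RespMod (Fn f k″ k) (RawAdm latMove latN (𝒦 f k″ k)) w (4/r·stepProd α k″ k·gen f k″)`. [folklore] -/
theorem slicesModuli_under_history {Gate : ℕ → Prop} {Fn : B.Birth → ℕ → ℕ → Fld d R → ℂ}
    {rel : B.Birth → ℕ → ℕ → Fld d R → Fld d R → Prop} {𝒦 : B.Birth → ℕ → ℕ → Set (Fld d R)}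
    {ref : B.Birth → ℕ → Fld d R → Fld d R} {base : B.Birth → ℕ → Fld d R → ℝ}
    {𝒜 𝒬 : B.Birth → ℕ → Fld d R → Fld d R → ℂ} {q : B.Birth → ℕ → Fld d R → ℂ}
    {μ : B.Birth → ℕ → Measure (Fld d R)} {z₀ z₁ : B.Birth → ℕ → Fld d R} {D : B.Birth → ℕ → Set (Fld d R)}
    {w r : ℝ} {s s1 θ ϱ₁ : B.Birth → ℕ → ℝ} {α : ℕ → ℝ} {ϱ rs Asz : B.Birth → ℕ → ℕ → ℝ}
    {S : ℕ → B.Birth → Finset (B.Birth × ℕ)} {c : B.Birth → ℕ → ℂ} {δf : B.Birth → ℕ → B.Birth × ℕ → ℝ}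
    (hα : ∀ i, 0 ≤ α i) (hr : 0 < r) (hw : 0 < w)
    (hsl : ∀ (b : B.Birth) (k' : ℕ), B.birthScale b ≤ k' → k' ≤ B.K → RanBelow Gate k' →
      BirthSlice (Fn b k' k') latMove latN (𝒦 b k' k') w r (T.gen b k'))
    (hFn : ∀ (b : B.Birth) (k' k : ℕ), B.birthScale b ≤ k' → k' ≤ k → k + 1 ≤ B.K → RanBelow Gate (k + 1) →
      ∀ U, Fn b k' (k + 1) U =
        wOp (expWeight (base b k) (𝒜 b k + 𝒬 b k)) (μ b k) (z₀ b k) U (fun z => Fn b k' k (U + z)))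
    (h𝒢 : ∀ (b : B.Birth) (k' k : ℕ), B.birthScale b ≤ k' → k' ≤ k → k + 1 ≤ B.K → RanBelow Gate (k + 1) →
      ∀ U, (fun z => Fn b k' k (U + z)) ∈ BddClass ℂ (μ b k))
    (hD : ∀ b k, (D b k).Nonempty) (hϱ : ∀ b k' k, 0 < ϱ b k' k)
    (hB : ∀ (b : B.Birth) (k' k : ℕ), B.birthScale b ≤ k' → k' ≤ k → k + 1 ≤ B.K → RanBelow Gate (k + 1) →
      RealBaseAt (ref b k) (base b k) (𝒜 b k) (μ b k) (𝒦 b k' (k + 1)))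
    (hE : ∀ (b : B.Birth) (k' k : ℕ), B.birthScale b ≤ k' → k' ≤ k → k + 1 ≤ B.K → RanBelow Gate (k + 1) →
      ExponentSliceAt (ref b k) (𝒜 b k) (μ b k) latMove latN (𝒦 b k' (k + 1)) w (ϱ b k' k) (s b k))
    (hQ : ∀ b k, (fun U z => 𝒬 b k U z - q b k U) =
      fun U z => c b k * ∑ p ∈ S k b, (Fn p.1 p.2 k (U + z) - Fn p.1 p.2 k (U + z₁ b k)))
    (hS : ∀ k b, ∀ p ∈ S k b, B.birthScale p.1 ≤ p.2 ∧ p.2 ≤ k)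
    (hs1 : ∀ b k, s1 b k = ‖c b k‖ * ∑ p ∈ S k b, (4 / r * stepProd α p.2 k * T.gen p.1 p.2) * δf b k p)
    (hAsz_birth : ∀ f k'', Asz f k'' k'' = T.gen f k'') (hrs_birth : ∀ f k'', rs f k'' k'' = r)
    (hAsz_step : ∀ f k'' k, B.birthScale f ≤ k'' → k'' ≤ k →
      Asz f k'' (k + 1) = Real.exp (3 * (s f k + s1 f k)) * Asz f k'' k)
    (hrs_step : ∀ f k'' k, B.birthScale f ≤ k'' → k'' ≤ k → rs f k'' (k + 1) = ϱ f k'' k)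
    (hrs_dec : ∀ f k'' k, B.birthScale f ≤ k'' → k'' ≤ k → ϱ f k'' k < rs f k'' k)
    (hmargin : ∀ (b : B.Birth) (k' k : ℕ), B.birthScale b ≤ k' → k' ≤ k →
      ϱ b k' k < ϱ₁ b k ∧ 0 < ϱ₁ b k ∧ ∀ p ∈ S k b, ϱ₁ b k ≤ rs p.1 p.2 k)
    (hDμ : ∀ b k, ∀ᵐ z ∂μ b k, z ∈ D b k)
    (hN1 : ∀ (b : B.Birth) (k' k : ℕ), B.birthScale b ≤ k' → k' ≤ k → k + 1 ≤ B.K →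
      ∀ z ∈ D b k, ∀ U ∈ 𝒦 b k' (k + 1), U + z ∈ 𝒦 b k' k)
    (hN2 : ∀ (b : B.Birth) (k' k : ℕ), B.birthScale b ≤ k' → k' ≤ k → k + 1 ≤ B.K →
      ∀ U₀ ∈ 𝒦 b k' (k + 1), ∀ p : NDir d R, latN p ≤ w → ∀ z' ∈ D b k, latMove U₀ p 1 + z' ∈ 𝒦 b k' k)
    (hN1x : ∀ (b : B.Birth) (k' k : ℕ), B.birthScale b ≤ k' → k' ≤ k →
      ∀ p ∈ S k b, ∀ z ∈ D b k, ∀ U ∈ 𝒦 b k' (k + 1), U + z ∈ 𝒦 p.1 p.2 k)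
    (hN2cx : ∀ (b : B.Birth) (k' k : ℕ), B.birthScale b ≤ k' → k' ≤ k →
      ∀ p ∈ S k b, ∀ U₀ ∈ 𝒦 b k' (k + 1), ∀ pd : NDir d R, 0 < latN pd → latN pd ≤ w →
        ∀ t ∈ tube (ϱ₁ b k / latN pd), latMove U₀ pd t + z₁ b k ∈ 𝒦 p.1 p.2 k)
    (hpairx : ∀ (b : B.Birth) (k' k : ℕ), B.birthScale b ≤ k' → k' ≤ k →
      ∀ p ∈ S k b, ∀ U₀ ∈ 𝒦 b k' (k + 1), ∀ pd : NDir d R, 0 < latN pd → latN pd ≤ w →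
        ∀ᵐ z ∂μ b k, ∀ t ∈ tube (ϱ₁ b k / latN pd),
          RelGauge (rel p.1 p.2 k) latMove latN (latMove U₀ pd t + z₁ b k) (latMove U₀ pd t + z) (δf b k p))
    (hδfw : ∀ b k, ∀ p ∈ S k b, δf b k p ≤ w)
    (hdiam : ∀ b k, ∀ z ∈ D b k, ∀ z' ∈ D b k, ∀ x ν, ‖z x ν - z' x ν‖ ≤ θ b k)
    (hθ : ∀ b k, 0 < θ b k ∧ θ b k ≤ w)
    (hdom : ∀ (b : B.Birth) (k' k : ℕ), B.birthScale b ≤ k' → k' ≤ k → k + 1 ≤ B.K →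
      Real.exp 3 * (1 + 4 * θ b k / ϱ b k' k) ≤ α k)
    (hinv : ∀ b k' k, GaugeInvariant (rel b k' k) (Fn b k' k))
    (hmeas : ∀ (b f : B.Birth) (k'' k : ℕ) (U : Fld d R), AEStronglyMeasurable (fun z => Fn f k'' k (U + z)) (μ b k))
    (hbudget : ∀ k, k < B.K → Gate k → ∀ b : B.Birth, B.birthScale b ≤ k → s b k + s1 b k ≤ 1) :
    ∀ k, k ≤ B.K → RanBelow Gate k → ∀ (f : B.Birth) (k'' : ℕ), B.birthScale f ≤ k'' → k'' ≤ k →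
      (0 ≤ Asz f k'' k ∧ BirthSlice (Fn f k'' k) latMove latN (𝒦 f k'' k) w (rs f k'' k) (Asz f k'' k)) ∧
        RespMod (Fn f k'' k) (RawAdm latMove latN (𝒦 f k'' k)) w (4 / r * stepProd α k'' k * T.gen f k'') := by
  -- exact recentring of the step law
  have e : ∀ b k, 𝒜 b k + 𝒬 b k = (𝒜 b k + fun U z => 𝒬 b k U z - q b k U) + fun U _ => q b k U := fun b k => by
    funext U z
    simp only [Pi.add_apply]
    ring
  -- nonnegativity of the moduli
  have hM0 : ∀ f k'' k, 0 ≤ 4 / r * stepProd α k'' k * T.gen f k'' := fun f k'' k =>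
    mul_nonneg (mul_nonneg (by positivity) (stepProd_nonneg hα _ _)) (T.gen_nonneg f k'')
  -- the birth case, at any step
  have hbirth : ∀ (f : B.Birth) (k : ℕ), B.birthScale f ≤ k → k ≤ B.K → RanBelow Gate k →
      (0 ≤ Asz f k k ∧ BirthSlice (Fn f k k) latMove latN (𝒦 f k k) w (rs f k k) (Asz f k k)) ∧
        RespMod (Fn f k k) (RawAdm latMove latN (𝒦 f k k)) w (4 / r * stepProd α k k * T.gen f k) := by
    intro f k hf hK hran
    rw [hAsz_birth, hrs_birth]
    exact ⟨⟨T.gen_nonneg f k, hsl f k hf hK hran⟩,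
      (respMod_raw_of_birthSlice (hsl f k hf hK hran) latMove_zero hr (T.gen_nonneg f k)).congr_const
        (by rw [stepProd_self]; ring)⟩
  intro k
  induction k with
  | zero =>
    intro hK hran f k'' hf hk''
    obtain rfl : k'' = 0 := Nat.le_zero.mp hk''
    exact hbirth f 0 hf hK hran
  | succ k ih =>
    intro hK hran f k'' hf hk''
    rcases Nat.lt_or_eq_of_le hk'' with hlt | heq
    · have hk''k : k'' ≤ k := Nat.lt_succ_iff.mp hlt
      have hkK : k < B.K := Nat.lt_of_succ_le hK
      have IH := ih hkK.le (hran.mono k.le_succ)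
      -- budget of step `k` for family `f`, read off the gate
      have hsk : s f k + s1 f k ≤ 1 := hbudget k hkK (hran k (Nat.lt_succ_self k)) f (hf.trans hk''k)
      -- the centred perturbation slice of `f`'s component at step `k`, from the live generations' MODULI (IH (ii))
      have hPk : PertSlice (fun U z => 𝒬 f k U z - q f k U) (μ f k) latMove latN (𝒦 f k'' (k + 1)) w (ϱ f k'' k)
          (s1 f k) := by
        rw [hQ f k, hs1 f k]
        obtain ⟨hϱϱ₁, hϱ₁0, hϱ₁r⟩ := hmargin f k'' k hf hk''k
        exact pertSlice_component_mod (S k f) (c f k) latMove_add_right latMove_zero (fun p _ => hinv p.1 p.2 k)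
          (fun p hp => (IH p.1 p.2 (hS k f p hp).1 (hS k f p hp).2).1.2)
          (fun p hp => (IH p.1 p.2 (hS k f p hp).1 (hS k f p hp).2).2) (fun p _ => hM0 p.1 p.2 k) hϱ₁r hϱϱ₁ hϱ₁0
          (hDμ f k) (hN1x f k'' k hf hk''k) (hN2cx f k'' k hf hk''k) (hpairx f k'' k hf hk''k) (hδfw f k)
          (fun p _ U => hmeas f p.1 p.2 k U)
      -- (i) one dressed step of the generation `(f, k'')` itself: the new slice
      have hstep := birthSlice_wOp_shift_dressed (z₀ := z₀ f k) latMove_add_right (hB f k'' k hf hk''k hK hran)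
        (hE f k'' k hf hk''k hK hran) hPk hsk (IH f k'' hf hk''k).1.2
        ((hDμ f k).mono fun z hz U hU => hN1 f k'' k hf hk''k hK z hz U hU) (fun U => hmeas f f k'' k U)
        (hrs_dec f k'' k hf hk''k) (IH f k'' hf hk''k).1.1
      have eFn : ∀ U, Fn f k'' (k + 1) U = wOp (expWeight (base f k) (𝒜 f k + fun U z => 𝒬 f k U z - q f k U))
          (μ f k) (z₀ f k) U (fun z => Fn f k'' k (U + z)) := by
        intro U
        rw [hFn f k'' k hf hk''k hK hran U, e f k, wOp_expWeight_add_zconst]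
      -- (ii) the step law of the component's normalised operation, and the continued modulus
      have hop : OpSliceOn (BddClass ℂ (μ f k))
          (wOp (expWeight (base f k) (𝒜 f k + fun U z => 𝒬 f k U z - q f k U)) (μ f k) (z₀ f k)) (D f k) latMove latN
          (𝒦 f k'' (k + 1)) w (ϱ f k'' k) (Real.exp 3) :=
        opSliceOn_mono_const (hD f k)
          (opSliceOn_wOp_dressed (z₀ f k) (hB f k'' k hf hk''k hK hran) (hE f k'' k hf hk''k hK hran) hPk hsk (hDμ f k))
          (Real.exp_le_exp.mpr (by linarith [hsk]))
      have hlaw := contStepLawOn_of_opSlice_windowed (𝒢 := BddClass ℂ (μ f k))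
        (E := wOp (expWeight (base f k) (𝒜 f k + fun U z => 𝒬 f k U z - q f k U)) (μ f k) (z₀ f k))
        (act := fun z U => U + z) (Adm' := Windowed (RawAdm latMove latN (𝒦 f k'' k)) w)
        (hD f k) (hϱ f k'' k) latMove_zero
        (supCost_of_opSliceOn (fun _ hg _ hg' => sub_mem_bddClass hg hg')
          (fun U _ hg _ hg' => wOp_sub _ (μ f k) (z₀ f k) U hg hg') hop latMove_zero (hϱ f k'' k).le (hdir_lattice hw))
        (opSliceOn_centred (fun c => const_mem_bddClass (μ f k) c) (fun _ hg _ hg' => sub_mem_bddClass hg hg')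
          (fun U _ hg _ hg' => wOp_sub _ (μ f k) (z₀ f k) U hg hg') (fun U c => wOp_const _ (μ f k) (z₀ f k) U c) hop)
        (fun U₀ U₁ δ hadm hδ z hz => ⟨hcov_add (hN1 f k'' k hf hk''k hK) U₀ U₁ δ hadm z hz, hδ⟩)
        (fun U₀ U₁ δ hadm hδ z hz z' hz' hzz =>
          ⟨hpair_add (hθ f k).1 (hdiam f k) (hN2 f k'' k hf hk''k hK) U₀ U₁ δ hadm hδ z hz z' hz' hzz, (hθ f k).2⟩)
        (hθ f k).1.le (hθ f k).2
      have hcont := hlaw.respMod_continue (G := Fn f k'' k) (h𝒢 f k'' k hf hk''k hK hran) (hM0 f k'' k)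
        (respMod_windowed_iff.mpr (IH f k'' hf hk''k).2)
      have hmono : RespMod (Fn f k'' (k + 1)) (RawAdm latMove latN (𝒦 f k'' (k + 1))) w
          (α k * (4 / r * stepProd α k'' k * T.gen f k'')) :=
        ((respMod_windowed_iff.mp hcont).congr_fun eFn).mono (fun _ _ _ h => rawAdm_nonneg h)
          (mul_le_mul_of_nonneg_right (by rw [stepFactor_eq]; exact hdom f k'' k hf hk''k hK) (hM0 f k'' k))
      have hmod : RespMod (Fn f k'' (k + 1)) (RawAdm latMove latN (𝒦 f k'' (k + 1))) w
          (4 / r * stepProd α k'' (k + 1) * T.gen f k'') :=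
        hmono.congr_const (by rw [stepProd_succ α hk''k]; ring)
      rw [hAsz_step f k'' k hf hk''k, hrs_step f k'' k hf hk''k]
      refine ⟨⟨mul_nonneg (Real.exp_pos _).le (IH f k'' hf hk''k).1.1, ?_⟩, hmod⟩
      have eFn' : Fn f k'' (k + 1) = fun U => wOp (expWeight (base f k) (𝒜 f k + fun U z => 𝒬 f k U z - q f k U))
          (μ f k) (z₀ f k) U (fun z => Fn f k'' k (U + z)) := funext eFn
      rw [eFn']
      exact hstep
    · subst heq
      exact hbirth f (k + 1) hf hK hran

/-- **THE BINDER `hP` OF THE GATED CAPSTONES, MODULUS FORM** — under the history `RanBelow Gate (k+1)` the centred perturbation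
slice of the component of family `b` at step `k` holds on `𝒦 b k′ (k+1)` with radius `ϱ b k′ k` and size
`s1 b k = ‖c b k‖·Σ_{p∈S k b} (4/r·stepProd α p.2 k·gen p.1 p.2)·δf b k p` — the booking's own envelope currency, NO chart radius
in the constant.  This is EXACTLY the `hP` of `transportsFromVar_of_centredExponent_lattice_fam_gated` (END-F) with `s₁ := s1`.
[folklore] -/
theorem pertSlice_under_history_mod {Gate : ℕ → Prop} {Fn : B.Birth → ℕ → ℕ → Fld d R → ℂ}
    {rel : B.Birth → ℕ → ℕ → Fld d R → Fld d R → Prop} {𝒦 : B.Birth → ℕ → ℕ → Set (Fld d R)}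
    {ref : B.Birth → ℕ → Fld d R → Fld d R} {base : B.Birth → ℕ → Fld d R → ℝ}
    {𝒜 𝒬 : B.Birth → ℕ → Fld d R → Fld d R → ℂ} {q : B.Birth → ℕ → Fld d R → ℂ}
    {μ : B.Birth → ℕ → Measure (Fld d R)} {z₀ z₁ : B.Birth → ℕ → Fld d R} {D : B.Birth → ℕ → Set (Fld d R)}
    {w r : ℝ} {s s1 θ ϱ₁ : B.Birth → ℕ → ℝ} {α : ℕ → ℝ} {ϱ rs Asz : B.Birth → ℕ → ℕ → ℝ}
    {S : ℕ → B.Birth → Finset (B.Birth × ℕ)} {c : B.Birth → ℕ → ℂ} {δf : B.Birth → ℕ → B.Birth × ℕ → ℝ}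
    (hα : ∀ i, 0 ≤ α i) (hr : 0 < r) (hw : 0 < w)
    (hsl : ∀ (b : B.Birth) (k' : ℕ), B.birthScale b ≤ k' → k' ≤ B.K → RanBelow Gate k' →
      BirthSlice (Fn b k' k') latMove latN (𝒦 b k' k') w r (T.gen b k'))
    (hFn : ∀ (b : B.Birth) (k' k : ℕ), B.birthScale b ≤ k' → k' ≤ k → k + 1 ≤ B.K → RanBelow Gate (k + 1) →
      ∀ U, Fn b k' (k + 1) U =
        wOp (expWeight (base b k) (𝒜 b k + 𝒬 b k)) (μ b k) (z₀ b k) U (fun z => Fn b k' k (U + z)))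
    (h𝒢 : ∀ (b : B.Birth) (k' k : ℕ), B.birthScale b ≤ k' → k' ≤ k → k + 1 ≤ B.K → RanBelow Gate (k + 1) →
      ∀ U, (fun z => Fn b k' k (U + z)) ∈ BddClass ℂ (μ b k))
    (hD : ∀ b k, (D b k).Nonempty) (hϱ : ∀ b k' k, 0 < ϱ b k' k)
    (hB : ∀ (b : B.Birth) (k' k : ℕ), B.birthScale b ≤ k' → k' ≤ k → k + 1 ≤ B.K → RanBelow Gate (k + 1) →
      RealBaseAt (ref b k) (base b k) (𝒜 b k) (μ b k) (𝒦 b k' (k + 1)))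
    (hE : ∀ (b : B.Birth) (k' k : ℕ), B.birthScale b ≤ k' → k' ≤ k → k + 1 ≤ B.K → RanBelow Gate (k + 1) →
      ExponentSliceAt (ref b k) (𝒜 b k) (μ b k) latMove latN (𝒦 b k' (k + 1)) w (ϱ b k' k) (s b k))
    (hQ : ∀ b k, (fun U z => 𝒬 b k U z - q b k U) =
      fun U z => c b k * ∑ p ∈ S k b, (Fn p.1 p.2 k (U + z) - Fn p.1 p.2 k (U + z₁ b k)))
    (hS : ∀ k b, ∀ p ∈ S k b, B.birthScale p.1 ≤ p.2 ∧ p.2 ≤ k)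
    (hs1 : ∀ b k, s1 b k = ‖c b k‖ * ∑ p ∈ S k b, (4 / r * stepProd α p.2 k * T.gen p.1 p.2) * δf b k p)
    (hAsz_birth : ∀ f k'', Asz f k'' k'' = T.gen f k'') (hrs_birth : ∀ f k'', rs f k'' k'' = r)
    (hAsz_step : ∀ f k'' k, B.birthScale f ≤ k'' → k'' ≤ k →
      Asz f k'' (k + 1) = Real.exp (3 * (s f k + s1 f k)) * Asz f k'' k)
    (hrs_step : ∀ f k'' k, B.birthScale f ≤ k'' → k'' ≤ k → rs f k'' (k + 1) = ϱ f k'' k)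
    (hrs_dec : ∀ f k'' k, B.birthScale f ≤ k'' → k'' ≤ k → ϱ f k'' k < rs f k'' k)
    (hmargin : ∀ (b : B.Birth) (k' k : ℕ), B.birthScale b ≤ k' → k' ≤ k →
      ϱ b k' k < ϱ₁ b k ∧ 0 < ϱ₁ b k ∧ ∀ p ∈ S k b, ϱ₁ b k ≤ rs p.1 p.2 k)
    (hDμ : ∀ b k, ∀ᵐ z ∂μ b k, z ∈ D b k)
    (hN1 : ∀ (b : B.Birth) (k' k : ℕ), B.birthScale b ≤ k' → k' ≤ k → k + 1 ≤ B.K →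
      ∀ z ∈ D b k, ∀ U ∈ 𝒦 b k' (k + 1), U + z ∈ 𝒦 b k' k)
    (hN2 : ∀ (b : B.Birth) (k' k : ℕ), B.birthScale b ≤ k' → k' ≤ k → k + 1 ≤ B.K →
      ∀ U₀ ∈ 𝒦 b k' (k + 1), ∀ p : NDir d R, latN p ≤ w → ∀ z' ∈ D b k, latMove U₀ p 1 + z' ∈ 𝒦 b k' k)
    (hN1x : ∀ (b : B.Birth) (k' k : ℕ), B.birthScale b ≤ k' → k' ≤ k →
      ∀ p ∈ S k b, ∀ z ∈ D b k, ∀ U ∈ 𝒦 b k' (k + 1), U + z ∈ 𝒦 p.1 p.2 k)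
    (hN2cx : ∀ (b : B.Birth) (k' k : ℕ), B.birthScale b ≤ k' → k' ≤ k →
      ∀ p ∈ S k b, ∀ U₀ ∈ 𝒦 b k' (k + 1), ∀ pd : NDir d R, 0 < latN pd → latN pd ≤ w →
        ∀ t ∈ tube (ϱ₁ b k / latN pd), latMove U₀ pd t + z₁ b k ∈ 𝒦 p.1 p.2 k)
    (hpairx : ∀ (b : B.Birth) (k' k : ℕ), B.birthScale b ≤ k' → k' ≤ k →
      ∀ p ∈ S k b, ∀ U₀ ∈ 𝒦 b k' (k + 1), ∀ pd : NDir d R, 0 < latN pd → latN pd ≤ w →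
        ∀ᵐ z ∂μ b k, ∀ t ∈ tube (ϱ₁ b k / latN pd),
          RelGauge (rel p.1 p.2 k) latMove latN (latMove U₀ pd t + z₁ b k) (latMove U₀ pd t + z) (δf b k p))
    (hδfw : ∀ b k, ∀ p ∈ S k b, δf b k p ≤ w)
    (hdiam : ∀ b k, ∀ z ∈ D b k, ∀ z' ∈ D b k, ∀ x ν, ‖z x ν - z' x ν‖ ≤ θ b k)
    (hθ : ∀ b k, 0 < θ b k ∧ θ b k ≤ w)
    (hdom : ∀ (b : B.Birth) (k' k : ℕ), B.birthScale b ≤ k' → k' ≤ k → k + 1 ≤ B.K →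
      Real.exp 3 * (1 + 4 * θ b k / ϱ b k' k) ≤ α k)
    (hinv : ∀ b k' k, GaugeInvariant (rel b k' k) (Fn b k' k))
    (hmeas : ∀ (b f : B.Birth) (k'' k : ℕ) (U : Fld d R), AEStronglyMeasurable (fun z => Fn f k'' k (U + z)) (μ b k))
    (hbudget : ∀ k, k < B.K → Gate k → ∀ b : B.Birth, B.birthScale b ≤ k → s b k + s1 b k ≤ 1) :
    ∀ (b : B.Birth) (k' k : ℕ), B.birthScale b ≤ k' → k' ≤ k → k + 1 ≤ B.K → RanBelow Gate (k + 1) →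
      PertSlice (fun U z => 𝒬 b k U z - q b k U) (μ b k) latMove latN (𝒦 b k' (k + 1)) w (ϱ b k' k) (s1 b k) := by
  intro b k' k hbk' hk'k hK hran
  have IH := slicesModuli_under_history hα hr hw hsl hFn h𝒢 hD hϱ hB hE hQ hS hs1 hAsz_birth hrs_birth hAsz_step hrs_step
    hrs_dec hmargin hDμ hN1 hN2 hN1x hN2cx hpairx hδfw hdiam hθ hdom hinv hmeas hbudget k ((Nat.le_succ k).trans hK)
    (hran.mono k.le_succ)
  have hM0 : ∀ f k'' k, 0 ≤ 4 / r * stepProd α k'' k * T.gen f k'' := fun f k'' k =>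
    mul_nonneg (mul_nonneg (by positivity) (stepProd_nonneg hα _ _)) (T.gen_nonneg f k'')
  rw [hQ b k, hs1 b k]
  obtain ⟨hϱϱ₁, hϱ₁0, hϱ₁r⟩ := hmargin b k' k hbk' hk'k
  exact pertSlice_component_mod (S k b) (c b k) latMove_add_right latMove_zero (fun p _ => hinv p.1 p.2 k)
    (fun p hp => (IH p.1 p.2 (hS k b p hp).1 (hS k b p hp).2).1.2)
    (fun p hp => (IH p.1 p.2 (hS k b p hp).1 (hS k b p hp).2).2) (fun p _ => hM0 p.1 p.2 k) hϱ₁r hϱϱ₁ hϱ₁0 (hDμ b k)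
    (hN1x b k' k hbk' hk'k) (hN2cx b k' k hbk' hk'k) (hpairx b k' k hbk' hk'k) (hδfw b k) (fun p _ U => hmeas b p.1 p.2 k U)

end AssemblyMod

end

end Summit.QuantumFields.BalabanUV.T4Continuum.T4TrajectoryDensityDressed
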